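import Literature.MathematicalPhysics.QuantumFieldTheory.Balaban1983to89.B15Claim189PinsOfHistory
import Literature.MathematicalPhysics.QuantumFieldTheory.Balaban1983to89.Node00.Record13CarriersWChi

/-!
# [Balaban1989LargeFieldI] §1 — χ-GENERIC RE-ISSUE (WORK ORDER RC-1 «RE-CENTRE THE RECORD», director-ym №462 (B) ∕ №467 (D)) of the STAGE-13-KEYED
# declarations of `B15Claim189PinsOfHistory`: the (1.100) pin `ResidW.pinRPrime₁₃Chi λ θ χ`, the (1.89) letters of record `D189OfRecord₁₃Chi θ χ`, print's number
# `N₀` of record `N0OfRecord₁₃Chi θ χ`, and the Record-13 instances of the history-generic window ∕ unit-test theorems — all in the β-slot `χ`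

CITATION HEADER.  [IV] = [Balaban1989LargeFieldI] (Commun. Math. Phys. **122** (1989) 175–202): (0.2)–(0.6) p.176, p.177 (the memory `N`), (1.2) p.178, (1.10) p.179, p.181,
(1.80) p.195, (1.82) p.196, (1.89) p.198, pp.199–200 (print's two conditions and `N₀`), (1.100)–(1.102) p.201; [III] = [Balaban1988Convergent] (CMP **119**): (2.1) p.254,
(2.4)–(2.8) pp.255–256, (2.18) p.257, (3.25) p.270; [I] = [Balaban1987RG1] (CMP **109**): (0.17)–(0.20) pp.255–256 (the generated history), §1 p.264 (β), (2.9) p.266 (the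
fluctuation cut-off — the CENTRE re-pointed by RC-1); [B16] = [Balaban1989LargeFieldII] (CMP **122**) Thm 1 p.355.

WHY (cell `pub-ymgap`, seat `pub-ymgap-dag-n12-d` g36, N12 [B15] s2; count-neutral helper of K1ᴬ `stmt-QuantumFields-27239`; dag-lead g40 WORDS 584 GO).  The parent module
(this seat's g6) is HISTORY-GENERIC by design: every pin ∕ letter ∕ window theorem is stated along an arbitrary coupling history `g` (`D189OfHist ν P σ g`, `pinD189H`,
`pinD189TH ∕ ZH`, `sitOfHist`, `claim189_sitOfHist_of_inInterval`, `displays_tested_at_one_pinD189TH`), and only its Stage-13 INSTANCES read the record's history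
`gOfRecord₁₃ θ P` ∕ tower `reprTOfRecord₁₃ θ P` — which read the (2.9) centre through `betaOfRecord₁₃ → chiβOfRecord₁₃` (kernel σ-closure `N12-SIGMA-CLOSURE-Ax.g36.md`,
evidence #2 on 27239: `N0OfRecord₁₃`, `ResidW.pinRPrime₁₃` are 2 of the 4 definitions through which the centre enters N12's road).  THIS FILE re-issues exactly those
instances VERBATIM over [Ax-3b]'s χ-generic carriers (`Node00/Record13Chi`: `gOfRecord₁₃Chi θ χ`, `reprTOfRecord₁₃Chi θ χ`, `betaOfRecord₁₃Chi θ χ`, `Provisos₁₃Chi`,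
`datumOfRecord₁₃Chi`) and this seat's `WOfRecord₁₃Chi` (`Node00/Record13CarriersWChi`), σ = (`gOfRecord₁₃ F N θ ↦ gOfRecord₁₃Chi F N θ χ`, `reprTOfRecord₁₃ ↦ reprTOfRecord₁₃Chi`,
`betaOfRecord₁₃ ↦ betaOfRecord₁₃Chi`, `WOfRecord₁₃ ↦ WOfRecord₁₃Chi`, `Provisos₁₃ ↦ Provisos₁₃Chi`, `datumOfRecord₁₃ ↦ datumOfRecord₁₃Chi`; names `X ↦ XChi`, theorems
`↦ …_chi`), in the parent's namespace.  At `χ := chiβOfRecord₁₃ θ` every declaration IS the parent's (receipts §R, `rfl`); at `χ := chiβOfRecord₁₃Ax θ` it is what the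
re-centred record's N12 road reads.  NOTHING of record edited (body-freeze №460 (2)); the history-generic theorems are CONSUMED BY NAME, not copied.

WHAT IS DEFINED ∕ PROVED (kernel bookkeeping, 0 sorry): §1 `ResidW.pinRPrime₁₃Chi` (def) + faces (`rfl`), `WOfRecord₁₃Chi_pinRPrime₁₃Chi` (`rfl`), `rPrime1100_pinRPrime₁₃Chi_D1100`
(module 1's `rPrime1100_rPrimeDataOfSel`), `exists_residW_pinRPrime₁₃Chi`; §2 `D189OfRecord₁₃Chi` (def) + `rfl` faces, the pins' commutation with §1 (`rfl`); §3 `N0OfRecord₁₃Chi`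
(def) + `rfl`; §4 `claim189_sitOfHist₁₃_N0_of_inInterval_chi` (the parent's §7 along `gOfRecord₁₃Chi θ χ P = genSeq (betaOfRecord₁₃Chi θ χ) g₀`); §5 `flow_datumOfRecord₁₃_chi` (`rfl`),
`flow_eq_genFlow_of_C_eq₁₃_chi`, `displays_tested_at_one_pinD189TH₁₃_of_admissible_chi`; §R the three receipts at `χ := chiβOfRecord₁₃ θ` (`rfl`); §A the shipped Ax instances `ResidW.pinRPrime₁₃Ax`, `D189OfRecord₁₃Ax`, `N0OfRecord₁₃Ax` (same arity as the bare names, node00-def-Y's design rule) + `rfl` unfolding.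
HONEST FRAMING: definitions over a parameter + `rfl` dictionary + the parent's history-generic theorems instantiated; NO estimate; nothing of Bałaban's analysis asserted,
ported or discharged; N12 NOT discharged; K0ᴬ ∕ K1ᴬ ∕ K3ᴬ OPEN; counts unmoved; one finite 𝕋⁴ programme at fixed `ε = L^{-K}` — NOT continuum ∕ ℝ⁴ ∕ OS; NOT the Yang–Mills
mass gap (Clay).  No `sorry`, no `axiom`, no `instance`, no `notation`.
-/

noncomputable section

open scoped BigOperators
open MeasureTheory

namespace Literature.MathematicalPhysics.QuantumFieldTheory.Balaban1983to89

namespace B15Claim189PinsOfHistory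

open DagBinding T4Continuum Node00
open B15 (Prop1Printed Ineq180)
open B15.BasicStep (Claim189 RopReal)
open B15.PrelimIntegrations (Ineq191 Ineq195)
open B15Chi124DetSets (E124)
open B15DeterminingSets (MSField)
open B15Sect1Statements (rPrime1100)
open B15Claim189Assembly (Setting189 new189 chiPP dom half)
open B15Claim189PrintedConditions (omegaOfChain)
open B15Claim189N0OfRecord (N0OfSeq)
open B15Claim189FlowAtRecord (betaAlongHistory_le_of_betaUpperH)
open B15RPrime1100OfRep (rPrimeDataOfSel rPrime1100_rPrimeDataOfSel)
open B15LeafKnitRepr (WOfRepr)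
open B14DomainGeom (Pt)
open B8Eq17ClassAkV1 (plaqsOf)
open GaugeGroup (dist1)
open GaugeField (plaqHol)
open FlowStep (HBeta prefixOf BetaUpperH)
open FlowStepRuns (genSeq genFlow)
open B14FlowStep (SmallnessFor)

variable {F : T4Family} {N : ℕ} [NeZero N]

/-! ## §1. The (1.100) pin at Record 13, χ-generic -/

section RPrime13Chi

/-- **THE (1.100)-PINNED RESIDUAL LAYER AT RECORD 13, χ-GENERIC**: `λ` with its (1.100) data REPLACED, per run, by module 1's (1.100)-reading `rPrimeDataOfSel` of the 𝐑-step of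
the χ-generic pre-𝐑 tower `reprTOfRecord₁₃Chi θ χ P (kSel P)` with the selector of record at level `kSel P + 1` along the χ-generic history `gOfRecord₁₃Chi θ χ P` and the
fibre bonds there (exactly what `WOfRecord₁₃Chi` reads) — the verbatim body of `ResidW.pinRPrime₁₃` in the β-slot `χ`.  Data, no law.
[cite: Balaban1989LargeFieldI, (1.100) p.201, (0.3) p.176; Balaban1988Convergent, (3.25) p.270; Balaban1987RG1, (2.9) p.266] -/
def _root_.Literature.MathematicalPhysics.QuantumFieldTheory.Balaban1983to89.Node00.ResidW.pinRPrime₁₃Chi (lam : ResidW F N) (θ : Stage13Params F N) (χ : ChiSlot F N) :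
    ResidW F N :=
  { lam with
    D1100 := fun P => rPrimeDataOfSel (reprTOfRecord₁₃Chi F N θ χ P (lam.kSel P)) (θ.ppSel P (gOfRecord₁₃Chi F N θ χ P) (lam.kSel P + 1))
      (fibOfSeq F θ.ν θ.τ9 P (gOfRecord₁₃Chi F N θ χ P) (lam.kSel P + 1)) }

variable (θ : Stage13Params F N) (χ : ChiSlot F N) (lam : ResidW F N)

/-- The pin keeps the step selector (`rfl`). [cite: Balaban1989LargeFieldI, (0.2) p.176 (bookkeeping)] -/
theorem pinRPrime₁₃Chi_kSel : (lam.pinRPrime₁₃Chi θ χ).kSel = lam.kSel := rfl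

/-- The pin keeps the Proposition-1 carrier (`rfl`). [cite: Balaban1989LargeFieldI, Prop. 1 p.194 (bookkeeping)] -/
theorem pinRPrime₁₃Chi_LF : (lam.pinRPrime₁₃Chi θ χ).LF = lam.LF := rfl

/-- The pin keeps the (1.89) letters (`rfl`). [cite: Balaban1989LargeFieldI, (1.89) p.198 (bookkeeping)] -/
theorem pinRPrime₁₃Chi_D189 : (lam.pinRPrime₁₃Chi θ χ).D189 = lam.D189 := rfl

/-- **The pinned (1.100) data at run `P`, χ-generic** (`rfl`) — the displayed pin equation `hpin` of N12's leaf constructors at the layer `λ.pinRPrime₁₃Chi θ χ`.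
[cite: Balaban1989LargeFieldI, (1.100) p.201 (bookkeeping)] -/
theorem pinRPrime₁₃Chi_D1100 (P : B12.RunParams) :
    (lam.pinRPrime₁₃Chi θ χ).D1100 P = rPrimeDataOfSel (reprTOfRecord₁₃Chi F N θ χ P (lam.kSel P)) (θ.ppSel P (gOfRecord₁₃Chi F N θ χ P) (lam.kSel P + 1))
      (fibOfSeq F θ.ν θ.τ9 P (gOfRecord₁₃Chi F N θ χ P) (lam.kSel P + 1)) := rfl

/-- Pinning twice is pinning once (`rfl`). [cite: Balaban1989LargeFieldI, (1.100) p.201 (bookkeeping)] -/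
theorem pinRPrime₁₃Chi_pinRPrime₁₃Chi : (lam.pinRPrime₁₃Chi θ χ).pinRPrime₁₃Chi θ χ = lam.pinRPrime₁₃Chi θ χ := rfl

/-- **THE χ-GENERIC [IV] BUNDLE AT THE PINNED LAYER** (`rfl`): `WOfRepr` of the χ-generic tower with the (1.100) data THE 𝐑-STEP'S OWN READING (the shape module 1's
`b15Leaf_WOfRepr_rPrimeDataOfSel_of_mass` and N12's integrable-form knit consume). [cite: Balaban1989LargeFieldI, (0.2) p.176, (1.100) p.201 (bookkeeping)] -/
theorem WOfRecord₁₃Chi_pinRPrime₁₃Chi (P : B12.RunParams) :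
    WOfRecord₁₃Chi F N θ χ (lam.pinRPrime₁₃Chi θ χ) P =
      WOfRepr (reprTOfRecord₁₃Chi F N θ χ P (lam.kSel P)) (θ.ppSel P (gOfRecord₁₃Chi F N θ χ P) (lam.kSel P + 1))
        (fibOfSeq F θ.ν θ.τ9 P (gOfRecord₁₃Chi F N θ χ P) (lam.kSel P + 1)) (lam.LF P) (lam.D189 P)
        (rPrimeDataOfSel (reprTOfRecord₁₃Chi F N θ χ P (lam.kSel P)) (θ.ppSel P (gOfRecord₁₃Chi F N θ χ P) (lam.kSel P + 1))
          (fibOfSeq F θ.ν θ.τ9 P (gOfRecord₁₃Chi F N θ χ P) (lam.kSel P + 1))) := rfl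

/-- **`h1100` AT THE χ-GENERIC RECORD IS A THEOREM**: 𝐑′ (1.100) of the pinned data IS the 𝐑-step (0.3) of the χ-generic pre-𝐑 tower (module 1's `rPrime1100_rPrimeDataOfSel`).
[cite: Balaban1989LargeFieldI, (1.100) p.201, (0.3) p.176] -/
theorem rPrime1100_pinRPrime₁₃Chi_D1100 (P : B12.RunParams) :
    rPrime1100 ((lam.pinRPrime₁₃Chi θ χ).D1100 P) =
      RopReal (rterm (reprTOfRecord₁₃Chi F N θ χ P (lam.kSel P))) (θ.ppSel P (gOfRecord₁₃Chi F N θ χ P) (lam.kSel P + 1))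
        (fibOfSeq F θ.ν θ.τ9 P (gOfRecord₁₃Chi F N θ χ P) (lam.kSel P + 1)) :=
  rPrime1100_rPrimeDataOfSel _ _ _

variable (F N) in
/-- **A2 — χ-generic (1.100)-pinned layers EXIST** for every parameter and every β-slot. [cite: Balaban1989LargeFieldI, (1.100) p.201 (bookkeeping witness)] -/
theorem exists_residW_pinRPrime₁₃Chi (θ : Stage13Params F N) (χ : ChiSlot F N) : ∃ lam : ResidW F N, lam.pinRPrime₁₃Chi θ χ = lam :=
  let ⟨lam₀⟩ := nonempty_residW F N
  ⟨lam₀.pinRPrime₁₃Chi θ χ, rfl⟩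

end RPrime13Chi

/-! ## §2. The (1.89) letters of Record 13, χ-generic; the token pins' commutation with §1 -/

section LettersChi

/-- **THE (1.89) LETTERS OF RECORD 13, χ-GENERIC** at `(θ, χ, P, σ)`: the letters along the χ-generic history `gOfRecord₁₃Chi θ χ P` — the verbatim body of `D189OfRecord₁₃`
in the β-slot `χ`. [cite: Balaban1989LargeFieldI, (1.89) p.198; Balaban1987RG1, (0.17)–(0.20) pp.255–256, (2.9) p.266 (objects of record)] -/
def D189OfRecord₁₃Chi (θ : Stage13Params F N) (χ : ChiSlot F N) (P : B12.RunParams) (σ : Sit189 F N P.K) :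
    Setting189 (F.P P.K) (SU N) (MSField (F.P P.K) (SU N) × ((j : ℕ) → VecField (F.P P.K) j σ.𝔤)) (Pt (F.P P.K).d) :=
  D189OfHist θ.ν P σ (gOfRecord₁₃Chi F N θ χ P)

/-- Unfolding (`rfl`). [cite: Balaban1989LargeFieldI, (1.89) p.198 (bookkeeping)] -/
theorem D189OfRecord₁₃Chi_eq (θ : Stage13Params F N) (χ : ChiSlot F N) (P : B12.RunParams) (σ : Sit189 F N P.K) :
    D189OfRecord₁₃Chi θ χ P σ = D189OfHist θ.ν P σ (gOfRecord₁₃Chi F N θ χ P) := rfl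

variable (lam : ResidW F N) (ν : Stage7Numerics) (g : B12.RunParams → ℕ → ℝ) (σ : ∀ P : B12.RunParams, Sit189 F N P.K)

/-- The D189 pin by the tokens commutes with §1's χ-generic (1.100) pin (`rfl`: disjoint fields). [cite: Balaban1989LargeFieldI, (1.89) p.198, (1.100) p.201 (bookkeeping)] -/
theorem pinD189H_pinRPrime₁₃Chi_comm (θ : Stage13Params F N) (χ : ChiSlot F N) :
    (lam.pinD189H ν g σ).pinRPrime₁₃Chi θ χ = (lam.pinRPrime₁₃Chi θ χ).pinD189H ν g σ := rfl

/-- At the χ-generic Record 13 (`g := gOfRecord₁₃Chi θ χ`) the pinned letters ARE `D189OfRecord₁₃Chi` (`rfl`). [cite: Balaban1989LargeFieldI, (1.89) p.198 (bookkeeping)] -/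
theorem pinD189H_D189_record₁₃_chi (θ : Stage13Params F N) (χ : ChiSlot F N) (P : B12.RunParams) :
    (lam.pinD189H θ.ν (gOfRecord₁₃Chi F N θ χ) σ).D189 P = D189OfRecord₁₃Chi θ χ P (σ P) := rfl

variable (A₁ : ℝ) (M : ℕ) (gT : B12.RunParams → ℕ → ℝ) (σT : ∀ P : B12.RunParams, Sit189 F N P.K)
  (sT : ∀ P : B12.RunParams, SeqOfRecord F ν M (gT P) P.K (lam.kSel P + 1)) (NmT N₀T : B12.RunParams → ℕ)
  (enl : ∀ P : B12.RunParams, ℕ → ℕ → Set (Site (F.P P.K) 0) → Set (Site (F.P P.K) 0)) (p₁ : ℕ)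

/-- The term-pinned layer commutes with §1's χ-generic (1.100) pin (`rfl`). [cite: Balaban1989LargeFieldI, (1.89) p.198, (1.100) p.201 (bookkeeping)] -/
theorem pinD189TH_pinRPrime₁₃Chi_comm (θ : Stage13Params F N) (χ : ChiSlot F N) :
    (lam.pinD189TH ν A₁ M gT σT sT NmT N₀T p₁).pinRPrime₁₃Chi θ χ = (lam.pinRPrime₁₃Chi θ χ).pinD189TH ν A₁ M gT σT sT NmT N₀T p₁ := rfl

/-- The `Z″`-pinned layer commutes with §1's χ-generic (1.100) pin (`rfl`). [cite: Balaban1989LargeFieldI, (1.89) p.198, (1.10) p.179, (1.100) p.201 (bookkeeping)] -/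
theorem pinD189ZH_pinRPrime₁₃Chi_comm (θ : Stage13Params F N) (χ : ChiSlot F N) :
    (lam.pinD189ZH ν A₁ M gT σT sT NmT N₀T enl p₁).pinRPrime₁₃Chi θ χ = (lam.pinRPrime₁₃Chi θ χ).pinD189ZH ν A₁ M gT σT sT NmT N₀T enl p₁ := rfl

end LettersChi

/-! ## §3. `N₀` of Record 13, χ-generic -/

section N0Chi

/-- **`N₀` OF RECORD 13, χ-GENERIC** at run `P` and level `k`: print's number (p. 200, `L^{−N₀+1}R_{k−N₀+1} = 1` read at its first solution, module 12's `N0OfSeq`) for the χ-generic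
Stage-13 history `gOfRecord₁₃Chi θ χ P` and the record's `L`, `r` — the verbatim body of `N0OfRecord₁₃` in the β-slot `χ`. [cite: Balaban1989LargeFieldI, p.200, p.181; Balaban1987RG1, (2.9) p.266] -/
def N0OfRecord₁₃Chi (θ : Stage13Params F N) (χ : ChiSlot F N) (P : B12.RunParams) (k : ℕ) : ℕ :=
  N0OfSeq (F.P P.K).L θ.ν.r (gOfRecord₁₃Chi F N θ χ P) k

/-- Unfolding (`rfl`). [cite: Balaban1989LargeFieldI, p.200 (bookkeeping)] -/
theorem N0OfRecord₁₃Chi_eq (θ : Stage13Params F N) (χ : ChiSlot F N) (P : B12.RunParams) (k : ℕ) :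
    N0OfRecord₁₃Chi θ χ P k = N0OfSeq (F.P P.K).L θ.ν.r (gOfRecord₁₃Chi F N θ χ P) k := rfl

end N0Chi

/-! ## §4. AT THE χ-GENERIC RECORD 13: the window form instantiated along `gOfRecord₁₃Chi θ χ P = genSeq (betaOfRecord₁₃Chi θ χ) g₀` -/

section Record13Chi

variable (θ : Stage13Params F N) (χ : ChiSlot F N) (Nm : ℕ) (P : B12.RunParams) (σ : Sit189 F N P.K) {k' : ℕ}
  (s : SeqOfRecord F θ.ν θ.τ9.M (gOfRecord₁₃Chi F N θ χ P) P.K k') (p₁ : ℕ)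

variable {θ χ} in
/-- **(1.89) AT THE TERM'S FULLY PINNED LETTERS OF THE χ-GENERIC RECORD 13 WITH `N₀ := N0OfRecord₁₃Chi θ χ P k′`, IN THE RUN'S (2.7)-SMALL WINDOW** — the parent's history-generic
`claim189_sitOfHist_of_inInterval` at the χ-generic Stage-13 tokens (exactly `claim189_sitOfHist₁₃_N0_of_inInterval` with `gOfRecord₁₃ ↦ gOfRecord₁₃Chi θ χ`,
`betaOfRecord₁₃ ↦ betaOfRecord₁₃Chi θ χ`, `N0OfRecord₁₃ ↦ N0OfRecord₁₃Chi θ χ`): the level input `2 ≤ N₀` from `r ≥ 1`, print's first p. 200 condition from ONE threshold on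
`g_{k′}` and `β ≥ 0` along the history, the flow inputs from the window `]0, θ.γ]` up to `k′` with the BOX bound `BetaUpperH β′ θ.γ (betaOfRecord₁₃Chi θ χ)`; memory `N` a
parameter (`N₀ ≤ N`); residual numerics, print's second condition, the located geometry, the ℍ-leaves and (1.80) displayed.
[cite: Balaban1989LargeFieldI, (1.89) p.198, pp.199–200; Balaban1988Convergent, (2.1) p.254, (2.4)–(2.8) pp.255–256; Balaban1987RG1, §1 p.264, (2.9) p.266] -/
theorem claim189_sitOfHist₁₃_N0_of_inInterval_chi
    {D : Setting189 (F.P P.K) (SU N) (MSField (F.P P.K) (SU N) × ((j : ℕ) → VecField (F.P P.K) j (EuclideanSpace ℝ (Fin (N ^ 2 - 1))))) (Pt (F.P P.K).d)}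
    (hD : D = D189OfHist θ.ν P (sitOfHist θ.ν θ.A₁ θ.τ9.M Nm P σ (gOfRecord₁₃Chi F N θ χ P) s (N0OfRecord₁₃Chi θ χ P k') p₁) (gOfRecord₁₃Chi F N θ χ P))
    (hr : 1 ≤ θ.ν.r) (hNN : N0OfRecord₁₃Chi θ χ P k' ≤ Nm) (hNk : N0OfRecord₁₃Chi θ χ P k' ≤ k')
    (hβ0 : 0 ≤ σ.β) (hβ : σ.β ≤ 1 / 4) (hL₀ : 2 ≤ σ.L₀) (hL₀L : σ.L₀ ^ 2 ≤ ((F.P P.K).L : ℝ))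
    (hB : 0 ≤ σ.O1 * σ.B₃ * σ.B₅) (hδ : 0 ≤ σ.δ) (hdist : ∀ p, 0 ≤ σ.dist p)
    (hwin : 4 * (2 + (121 / 120) ^ 2 * (σ.O1 * σ.B₃ * σ.B₅ * (θ.τ9.M : ℝ) ^ 5))
      ≤ ((Real.log (gOfRecord₁₃Chi F N θ χ P k' ^ 2)⁻¹) ^ θ.ν.r) ^ (Real.log (σ.L₀ ^ 2) / Real.log ((F.P P.K).L : ℝ)))
    (hβhist : ∀ j, j < k' → 0 ≤ betaOfRecord₁₃Chi F N θ χ j (prefixOf (gOfRecord₁₃Chi F N θ χ P) j))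
    (hMl : (121 / 120) ^ 2 * (σ.O1 * σ.B₃ * σ.B₅ * (θ.τ9.M : ℝ) ^ 5) * Real.exp (-(4 * σ.δ * (θ.τ9.M : ℝ))) ≤ 1 / 12)
    (hA₀ : 0 ≤ θ.ν.A₀) {β' β₀ : ℝ} {L : ℕ} (S : SmallnessFor θ.γ β' β₀ L θ.ν.p₀) (hβ₀ : β₀ ≤ 1 / 2) (hε10 : θ.γ * p0Profile θ.ν.A₀ θ.ν.p₀ θ.γ ≤ 1 / 10)
    (hI : Step.InInterval θ.γ k' (gOfRecord₁₃Chi F N θ χ P)) (hup : BetaUpperH β' θ.γ (betaOfRecord₁₃Chi F N θ χ))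
    (hZk : ∀ m, k' - N0OfRecord₁₃Chi θ χ P k' < m → m < k' → σ.Zpp k' ∩ omegaOfChain s m ⊆ omegaOfChain s (m + 1))
    (hgeom : ∀ m, D.k₀ < m → m < D.k → ∀ p ∈ plaqsOf (D.Ω m \ D.Ω (m + 1)), 4 * ((m : ℝ) - D.k₀) * D.M ≤ D.dist p)
    (hbox : ∀ p ∈ plaqsOf (half D), D.boxOf p ∈ D.halfcubes ∧ p ∈ D.plaqT (D.boxOf p))
    (L91h : ∀ U, new189 D U → ∀ p ∈ plaqsOf (half D),
      Ineq191 (dist1 (plaqHol (D.Upp U) p)) (D.devV'' U p) D.α ((D.L ^ D.h)⁻¹) (D.ε D.h) (E124 D.ε D.L D.η D.k D.h))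
    (L95 : ∀ U, new189 D U → ∀ p ∈ plaqsOf (half D),
      Ineq195 (D.devV'' U p) (dist1 (plaqHol (D.Uhalf U (D.boxOf p)) p)) D.α ((D.L ^ D.h)⁻¹) (D.ε D.h) (E124 D.ε D.L D.η D.k D.h))
    (L91 : ∀ U, new189 D U → ∀ j, D.h ≤ j → j ≤ D.k → ∀ p ∈ plaqsOf (dom D j),
      Ineq191 (dist1 (plaqHol (D.Upp U) p)) (D.dev97 U p) D.α ((D.L ^ j)⁻¹) (D.ε j) (E124 D.ε D.L D.η D.k j))
    (L97 : ∀ U, new189 D U → ∀ j, D.h ≤ j → j ≤ D.k → ∀ p ∈ plaqsOf (dom D j),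
      Ineq191 (D.dev97 U p) (D.dev0 U p) D.α ((D.L ^ j)⁻¹) (D.ε j) (E124 D.ε D.L D.η D.k j))
    (L80 : ∀ U, new189 D U → ∀ j, D.h ≤ j → j ≤ D.k → ∀ p ∈ plaqsOf (dom D j),
      Ineq180 (D.dev0 U p) (D.ε D.k) D.η D.B₃ D.B₅ D.M D.δ (D.dist p) D.O1) :
    Claim189 (new189 D) (chiPP D) :=
  claim189_sitOfHist_of_inInterval Nm P σ (N0OfRecord₁₃Chi θ χ P k') p₁ (betaOfRecord₁₃Chi F N θ χ) hD
    (two_le_N0OfSeq_of_hist θ.ν P (gOfRecord₁₃Chi F N θ χ P) (one_lt_log_pow_of_inInterval_hist θ.ν S hI hr)) hNN hNk hβ0 hβ hL₀ hL₀L hB hδ hdist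
    (printCond1_N0OfSeq_of_threshold θ.ν P (betaOfRecord₁₃Chi F N θ χ) S.γ_lt_one.le hI hβhist (by linarith) hwin) hMl hA₀ S hβ₀ hε10 hI
    (betaAlongHistory_le_of_betaUpperH hup hI) hZk hgeom hbox L91h L95 L91 L97 L80

end Record13Chi

/-! ## §5. The flow of the χ-generic datum; the unit test at the χ-generic Record 13 -/

section LeavesChi

variable {w : WorldP}

/-- **AT THE χ-GENERIC RECORD 13 THE RUN'S FLOW IS GENERATED FORWARD BY `betaOfRecord₁₃Chi θ χ`** (`rfl`, [Ax-3b]'s `datumOfRecord₁₃Chi` over `coreOfRecord₁₃Chi`): so at every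
world with `w.C = (datumOfRecord₁₃Chi θ χ h).C` the parent's three leaf lemmas read along `gOfRecord₁₃Chi θ χ P`. [cite: Balaban1987RG1, (0.17)–(0.20) pp.255–256 (bookkeeping)] -/
theorem flow_datumOfRecord₁₃_chi (θ : Stage13Params F N) (χ : ChiSlot F N) (h : θ.Provisos₁₃Chi F N χ) (P : B12.RunParams) :
    ((datumOfRecord₁₃Chi F N θ χ h).C P).flow = genFlow (betaOfRecord₁₃Chi F N θ χ) P.g0 := rfl

/-- … hence at a world keyed on the χ-generic Stage-13 datum. [cite: Balaban1987RG1, (0.17)–(0.20) pp.255–256 (bookkeeping)] -/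
theorem flow_eq_genFlow_of_C_eq₁₃_chi {θ : Stage13Params F N} {χ : ChiSlot F N} {h : θ.Provisos₁₃Chi F N χ} (hC : w.C = (datumOfRecord₁₃Chi F N θ χ h).C)
    (P : B12.RunParams) : (w.C P).flow = genFlow (betaOfRecord₁₃Chi F N θ χ) P.g0 := by
  rw [hC]
  exact flow_datumOfRecord₁₃_chi θ χ h P

end LeavesChi

section Admissible13Chi

variable {θ : Stage13Params F N} (χ : ChiSlot F N) (lam : ResidW F N) (σT : ∀ P : B12.RunParams, Sit189 F N P.K)
  (sT : ∀ P : B12.RunParams, SeqOfRecord F θ.ν θ.τ9.M (gOfRecord₁₃Chi F N θ χ P) P.K (lam.kSel P + 1)) (NmT N₀T : B12.RunParams → ℕ) (p₁ : ℕ)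

/-- **A2 AT THE χ-GENERIC RECORD 13 — BOTH [IV] DISPLAYS TESTED AT THE UNIT CONFIGURATION at the term-pinned layer along `gOfRecord₁₃Chi θ χ`, sign inputs READ OFF
ADMISSIBILITY** (the parent's history-generic `displays_tested_at_one_pinD189TH` at `g := gOfRecord₁₃Chi θ χ`): in the run's window `]0, θ.γ]` up to `n ≥ kSel P + 1`, residual
`0 ≤ β < 1`, `0 < L₀`, `0 ≤ O(1)B₃B₅`. [cite: Balaban1989LargeFieldI, (1.80) p.195, (1.89) p.198, (1.82) p.196, (1.24) p.182 (bookkeeping witness)] -/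
theorem displays_tested_at_one_pinD189TH₁₃_of_admissible_chi (hθ : θ.Admissible F N) (P : B12.RunParams) {n : ℕ}
    (hI : Step.InInterval θ.γ n (gOfRecord₁₃Chi F N θ χ P)) (hkn : lam.kSel P + 1 ≤ n) (hβ0 : 0 ≤ (σT P).β) (hβ1 : (σT P).β < 1) (hL₀ : 0 < (σT P).L₀)
    (hB : 0 ≤ (σT P).O1 * (σT P).B₃ * (σT P).B₅) :
    new189 ((lam.pinD189TH θ.ν θ.A₁ θ.τ9.M (gOfRecord₁₃Chi F N θ χ) σT sT NmT N₀T p₁).D189 P)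
        ((1 : MSField (F.P P.K) (SU N)), fun _ _ => (0 : EuclideanSpace ℝ (Fin (N ^ 2 - 1)))) ∧
    (∀ i, ((lam.pinD189TH θ.ν θ.A₁ θ.τ9.M (gOfRecord₁₃Chi F N θ χ) σT sT NmT N₀T p₁).D189 P).h ≤ i →
      i ≤ ((lam.pinD189TH θ.ν θ.A₁ θ.τ9.M (gOfRecord₁₃Chi F N θ χ) σT sT NmT N₀T p₁).D189 P).k →
      ∀ q ∈ plaqsOf (dom ((lam.pinD189TH θ.ν θ.A₁ θ.τ9.M (gOfRecord₁₃Chi F N θ χ) σT sT NmT N₀T p₁).D189 P) i),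
      Ineq180 (((lam.pinD189TH θ.ν θ.A₁ θ.τ9.M (gOfRecord₁₃Chi F N θ χ) σT sT NmT N₀T p₁).D189 P).dev0
          ((1 : MSField (F.P P.K) (SU N)), fun _ _ => (0 : EuclideanSpace ℝ (Fin (N ^ 2 - 1)))) q)
        (((lam.pinD189TH θ.ν θ.A₁ θ.τ9.M (gOfRecord₁₃Chi F N θ χ) σT sT NmT N₀T p₁).D189 P).ε
          ((lam.pinD189TH θ.ν θ.A₁ θ.τ9.M (gOfRecord₁₃Chi F N θ χ) σT sT NmT N₀T p₁).D189 P).k)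
        ((lam.pinD189TH θ.ν θ.A₁ θ.τ9.M (gOfRecord₁₃Chi F N θ χ) σT sT NmT N₀T p₁).D189 P).η
        ((lam.pinD189TH θ.ν θ.A₁ θ.τ9.M (gOfRecord₁₃Chi F N θ χ) σT sT NmT N₀T p₁).D189 P).B₃
        ((lam.pinD189TH θ.ν θ.A₁ θ.τ9.M (gOfRecord₁₃Chi F N θ χ) σT sT NmT N₀T p₁).D189 P).B₅
        ((lam.pinD189TH θ.ν θ.A₁ θ.τ9.M (gOfRecord₁₃Chi F N θ χ) σT sT NmT N₀T p₁).D189 P).M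
        ((lam.pinD189TH θ.ν θ.A₁ θ.τ9.M (gOfRecord₁₃Chi F N θ χ) σT sT NmT N₀T p₁).D189 P).δ
        (((lam.pinD189TH θ.ν θ.A₁ θ.τ9.M (gOfRecord₁₃Chi F N θ χ) σT sT NmT N₀T p₁).D189 P).dist q)
        ((lam.pinD189TH θ.ν θ.A₁ θ.τ9.M (gOfRecord₁₃Chi F N θ χ) σT sT NmT N₀T p₁).D189 P).O1) ∧
    chiPP ((lam.pinD189TH θ.ν θ.A₁ θ.τ9.M (gOfRecord₁₃Chi F N θ χ) σT sT NmT N₀T p₁).D189 P)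
      ((1 : MSField (F.P P.K) (SU N)), fun _ _ => (0 : EuclideanSpace ℝ (Fin (N ^ 2 - 1)))) :=
  have hs := signs_of_admissible₁₃ hθ
  displays_tested_at_one_pinD189TH lam (gOfRecord₁₃Chi F N θ χ) σT sT NmT N₀T p₁ hs.2.1 hs.1 hs.2.2.1 hs.2.2.2 P hI hkn hβ0 hβ1 hL₀ hB

end Admissible13Chi

/-! ## §R. Receipts: at `χ := chiβOfRecord₁₃ θ` the χ-generic declarations ARE the parent's (definitionally, through [Ax-3b]'s `rfl` receipts) -/

section Receipts

variable (θ : Stage13Params F N) (lam : ResidW F N)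

/-- RECEIPT (`rfl`): the χ-generic (1.100) pin at the record's own β-slot IS `pinRPrime₁₃`. [cite: Balaban1989LargeFieldI, (1.100) p.201; Balaban1987RG1, (2.9) p.266 (bookkeeping)] -/
theorem pinRPrime₁₃Chi_chiβ : lam.pinRPrime₁₃Chi θ (chiβOfRecord₁₃ F N θ) = lam.pinRPrime₁₃ θ := rfl

/-- RECEIPT (`rfl`): the χ-generic (1.89) letters of record at the record's own β-slot ARE `D189OfRecord₁₃`. [cite: Balaban1989LargeFieldI, (1.89) p.198; Balaban1987RG1, (2.9) p.266 (bookkeeping)] -/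
theorem D189OfRecord₁₃Chi_chiβ (P : B12.RunParams) (σ : Sit189 F N P.K) : D189OfRecord₁₃Chi θ (chiβOfRecord₁₃ F N θ) P σ = D189OfRecord₁₃ θ P σ := rfl

/-- RECEIPT (`rfl`): the χ-generic `N₀` of record at the record's own β-slot IS `N0OfRecord₁₃`. [cite: Balaban1989LargeFieldI, p.200; Balaban1987RG1, (2.9) p.266 (bookkeeping)] -/
theorem N0OfRecord₁₃Chi_chiβ (P : B12.RunParams) (k : ℕ) : N0OfRecord₁₃Chi θ (chiβOfRecord₁₃ F N θ) P k = N0OfRecord₁₃ θ P k := rfl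

end Receipts

/-! ## §A. The instances at the re-centred cut-off ([Ax-2] ∕ [Ax-3a]; node00-def-Y's design rule: `…Ax` one-line instances of the same arity as the bare names) -/

section AxInstances

/-- **THE (1.100)-PINNED LAYER OF THE RE-CENTRED RECORD**: `pinRPrime₁₃Chi` at `χ := chiβOfRecord₁₃Ax θ` (same arity as `ResidW.pinRPrime₁₃`).
[cite: Balaban1989LargeFieldI, (1.100) p.201; Balaban1987RG1, (2.9) p.266, p.265 (2.3) (the block-axial centre)] -/
abbrev _root_.Literature.MathematicalPhysics.QuantumFieldTheory.Balaban1983to89.Node00.ResidW.pinRPrime₁₃Ax (lam : ResidW F N) (θ : Stage13Params F N) : ResidW F N :=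
  lam.pinRPrime₁₃Chi θ (chiβOfRecord₁₃Ax F N θ)

/-- **THE (1.89) LETTERS OF THE RE-CENTRED RECORD**: `D189OfRecord₁₃Chi` at `χ := chiβOfRecord₁₃Ax θ` (same arity as `D189OfRecord₁₃`). [cite: Balaban1989LargeFieldI, (1.89) p.198; Balaban1987RG1, (2.9) p.266] -/
abbrev D189OfRecord₁₃Ax (θ : Stage13Params F N) (P : B12.RunParams) (σ : Sit189 F N P.K) :
    Setting189 (F.P P.K) (SU N) (MSField (F.P P.K) (SU N) × ((j : ℕ) → VecField (F.P P.K) j σ.𝔤)) (Pt (F.P P.K).d) :=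
  D189OfRecord₁₃Chi θ (chiβOfRecord₁₃Ax F N θ) P σ

/-- **`N₀` OF THE RE-CENTRED RECORD**: `N0OfRecord₁₃Chi` at `χ := chiβOfRecord₁₃Ax θ` (same arity as `N0OfRecord₁₃`). [cite: Balaban1989LargeFieldI, p.200; Balaban1987RG1, (2.9) p.266] -/
abbrev N0OfRecord₁₃Ax (θ : Stage13Params F N) (P : B12.RunParams) (k : ℕ) : ℕ :=
  N0OfRecord₁₃Chi θ (chiβOfRecord₁₃Ax F N θ) P k

/-- Unfolding of the Ax instances along `gOfRecord₁₃Ax` (`rfl` ×2). [cite: Balaban1989LargeFieldI, (1.89) p.198, p.200 (bookkeeping)] -/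
theorem D189OfRecord₁₃Ax_N0OfRecord₁₃Ax_eq (θ : Stage13Params F N) (P : B12.RunParams) (σ : Sit189 F N P.K) (k : ℕ) :
    D189OfRecord₁₃Ax θ P σ = D189OfHist θ.ν P σ (gOfRecord₁₃Ax F N θ P) ∧ N0OfRecord₁₃Ax θ P k = N0OfSeq (F.P P.K).L θ.ν.r (gOfRecord₁₃Ax F N θ P) k := ⟨rfl, rfl⟩

end AxInstances

end B15Claim189PinsOfHistory

end Literature.MathematicalPhysics.QuantumFieldTheory.Balaban1983to89

end
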